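import Mathlib
import Summits.Ventures.HodgeRepro.Night3ExtTop

/-!
# The 2-vector table of a slot pair and its symmetric-function atoms (pub-hsemireg, S4-PUSH corner 2)

Companion of `Summits/Ventures/HSemireg/DegreeSixSecondDigit.lean` (kernel leg for LEMMAS A(a)∕B∕D(a) of
`s4push/search-2/g11/LIFT2-search-2-g11.md` §5, cell `pub-hsemireg`, seat s4-search-2 gen 13).  That file states
the digit identities of the CRITERION L tower over an arbitrary commutative ring on a handful of ATOMS with a
product table as hypotheses; this file derives that table from the exterior algebra.

**Setting.**  `Λ^{ev} = ⊕_k Λ^{2k}ℤ¹²` (basis `x₀, …, x₁₁` of `H¹(E⁶, ℤ)`; slot `i` = `⟨x_{2i}, x_{2i+1}⟩`, `hᵢ :=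
x_{2i}x_{2i+1}`) is a commutative ring.  The edge unit of type `(2,2,3,3,3,3)` lives on the slot pair `0, 1`,
whose six 2-vectors are `h₀ = x₀x₁, h₁ = x₂x₃` and the four CROSS LINES `l₁ = x₀x₂, l₂ = x₀x₃, l₃ = x₁x₂, l₄ =
x₁x₃`, next to the outer slots `h₂, h₃, h₄, h₅`.

* Section `Convention` (Mathlib's `ExteriorAlgebra R M`, any module, any four vectors `x₀ x₁ x₂ x₃`): 2-vectors
  commute with each other (`twoVector_comm`, by `HodgeRepro.Night3.ExtTop.two_form_comm`), square to zero
  (`twoVector_mul_self`), and the slot-pair table holds: `h₀lᵢ = h₁lᵢ = l₁l₂ = l₁l₃ = l₂l₄ = l₃l₄ = 0`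
  (`table_zero`), `l₁l₄ = −h₀h₁`, `l₂l₃ = h₀h₁` (`table_signed`).  These are exactly the hypotheses `qhᵢ`, `qlⱼ`,
  `zh₀l₁ … zl₃l₄`, `pl₁l₄`, `pl₂l₃` used below.
* Section `Atoms` (any commutative ring, elements satisfying that table): the ATOM TABLE assumed by
  `DegreeSixSecondDigit` — for the pair sums `H := h₀ + h₁`, `H₂ := h₀h₁`: `H·H = 2H₂`, `H·H₂ = 0`, `H₂·H₂ = 0`
  (`pairSum_*`); for the slot sums `S_k := e_k(h₂, h₃, h₄, h₅)` (elementary symmetric): the divided-power law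
  `S_j·S_k = C(j+k, j)·S_{j+k}`, `S_k = 0` for `k > 4` — `S₁S₁ = 2S₂, S₁S₂ = 3S₃, S₁S₃ = 4S₄, S₂S₂ = 6S₄`, `S₁S₄ =
  S₂S₃ = S₂S₄ = S₃S₃ = S₃S₄ = S₄S₄ = 0` (`slotSum_*`); for a cross-line element `L := a l₁ + b l₂ + c l₃ + d l₄`
  (any coefficients): `h₀L = h₁L = 0`, `L·L = 2(bc − ad)h₀h₁`, its divided square (elementary symmetric square of
  the four summands) is `(bc − ad)·h₀h₁` and its divided cube is `0` (`crossLine_*`) — i.e. `L·L = 2L₂` with `L₂ =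
  λH₂`, `λ = bc − ad`, and `HL = H₂L = 0`; the pairing of a cross line with `N = n₁l₁ + ⋯ + n₄l₄`: `l₄N = −n₁h₀h₁,
  l₃N = n₂h₀h₁, l₂N = n₃h₀h₁, l₁N = −n₄h₀h₁` (`crossLine_pair*`, the hypothesis `hFN` of
  `DegreeSixSecondDigit.obstruction`); `S₁·G = S₄` for `G = h₃h₄h₅` (`slotSum_G`); and the same divided-power law
  `P₁P₁ = 2P₂`, `P₁P₂ = 3P₃` for the clique sums of 3, 5, 6 square-zero slots (`cliqueSum_*`, the atoms of
  `CliqueUnitKills.lean`).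

All proofs are `rw` chains in the exterior algebra or `linear_combination` certificates (explicit cofactors found
by exact reduction in the free polynomial ring; generator `s4push/search-2/g13/cert/gen4.py`, stdlib only). Honest
framing: elementary multilinear algebra (theorems only, count-neutral); bookkeeping for a kernel check of pencil
steps of a CLASS-LEVEL necessary-condition sieve at the special fibre `E⁶`; nothing here is an object, a `σ`
computation or a Hodge statement, and nothing here bears on HC ∕ HC_CM ∕ HC_AV.
-/

namespace Summit.Ventures.HSemireg.TwoSlotFrameTable

section Convention

/-! ### 0. The 2-vector multiplication table (convention check in Mathlib's `ExteriorAlgebra`) -/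

open ExteriorAlgebra (ι)
open HodgeRepro.Night3.ExtTop (ι_mul_ι_eq_neg two_form_comm)

variable {R : Type*} [CommRing R] {M : Type*} [AddCommGroup M] [Module R M]

/-- 2-vectors commute: `(ι u ι v)(ι u' ι v') = (ι u' ι v')(ι u ι v)` — an instance of
`HodgeRepro.Night3.ExtTop.two_form_comm` (a 2-vector is central in the exterior algebra); so the 2-vectors of the
frame generate a COMMUTATIVE subring (inside the even part), which is why the atom table and the digit identities
may be stated in a commutative ring. -/
theorem twoVector_comm (u v u' v' : M) :
    ι R u * ι R v * (ι R u' * ι R v') = ι R u' * ι R v' * (ι R u * ι R v) :=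
  two_form_comm u v _

/-- `(ι x ι p)(ι x ι q) = 0` (shared first vector). -/
theorem table_zero_ff (x p q : M) : ι R x * ι R p * (ι R x * ι R q) = 0 := by
  rw [ι_mul_ι_eq_neg x p, neg_mul, mul_assoc, ← mul_assoc (ι R x) (ι R x), ExteriorAlgebra.ι_sq_zero,
    zero_mul, mul_zero, neg_zero]

/-- Table entry «square»: `(ι u * ι v) * (ι u * ι v) = 0` — every 2-vector of the frame squares to zero
(`hᵢ² = lⱼ² = 0`, the hypotheses `qh₀ … qh₅`, `ql₁ … ql₄` of section `Atoms`). -/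
theorem twoVector_mul_self (u v : M) : ι R u * ι R v * (ι R u * ι R v) = 0 :=
  table_zero_ff u v v

/-- `(ι x ι p)(ι q ι x) = 0` (first vector = last vector). -/
theorem table_zero_fl (x p q : M) : ι R x * ι R p * (ι R q * ι R x) = 0 := by
  rw [ι_mul_ι_eq_neg q x, mul_neg, table_zero_ff, neg_zero]

/-- `(ι p ι x)(ι x ι q) = 0` (second vector = third vector). -/
theorem table_zero_st (p x q : M) : ι R p * ι R x * (ι R x * ι R q) = 0 := by
  rw [mul_assoc, ← mul_assoc (ι R x) (ι R x), ExteriorAlgebra.ι_sq_zero, zero_mul, mul_zero]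

/-- `(ι p ι x)(ι q ι x) = 0` (second vector = last vector). -/
theorem table_zero_sl (p x q : M) : ι R p * ι R x * (ι R q * ι R x) = 0 := by
  rw [ι_mul_ι_eq_neg q x, mul_neg, table_zero_st, neg_zero]

/-- **The twelve vanishing products of the slot pair.**  With `h₀ = x₀x₁, h₁ = x₂x₃, l₁ = x₀x₂, l₂ = x₀x₃,
l₃ = x₁x₂, l₄ = x₁x₃` (any four vectors `x₀ x₁ x₂ x₃` of any module):
`h₀l₁ = h₀l₂ = h₀l₃ = h₀l₄ = h₁l₁ = h₁l₂ = h₁l₃ = h₁l₄ = l₁l₂ = l₁l₃ = l₂l₄ = l₃l₄ = 0` — exactly the hypotheses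
`zh₀l₁ … zl₃l₄` of section `Atoms`. -/
theorem table_zero (x₀ x₁ x₂ x₃ : M) :
    ι R x₀ * ι R x₁ * (ι R x₀ * ι R x₂) = 0 ∧ ι R x₀ * ι R x₁ * (ι R x₀ * ι R x₃) = 0 ∧
    ι R x₀ * ι R x₁ * (ι R x₁ * ι R x₂) = 0 ∧ ι R x₀ * ι R x₁ * (ι R x₁ * ι R x₃) = 0 ∧
    ι R x₂ * ι R x₃ * (ι R x₀ * ι R x₂) = 0 ∧ ι R x₂ * ι R x₃ * (ι R x₀ * ι R x₃) = 0 ∧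
    ι R x₂ * ι R x₃ * (ι R x₁ * ι R x₂) = 0 ∧ ι R x₂ * ι R x₃ * (ι R x₁ * ι R x₃) = 0 ∧
    ι R x₀ * ι R x₂ * (ι R x₀ * ι R x₃) = 0 ∧ ι R x₀ * ι R x₂ * (ι R x₁ * ι R x₂) = 0 ∧
    ι R x₀ * ι R x₃ * (ι R x₁ * ι R x₃) = 0 ∧ ι R x₁ * ι R x₂ * (ι R x₁ * ι R x₃) = 0 :=
  ⟨table_zero_ff _ _ _, table_zero_ff _ _ _, table_zero_st _ _ _, table_zero_st _ _ _,
   table_zero_fl _ _ _, table_zero_sl _ _ _, table_zero_fl _ _ _, table_zero_sl _ _ _,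
   table_zero_ff _ _ _, table_zero_sl _ _ _, table_zero_sl _ _ _, table_zero_ff _ _ _⟩

/-- **The two signed products of the slot pair**: `l₁l₄ = (x₀x₂)(x₁x₃) = −(x₀x₁)(x₂x₃) = −h₀h₁` and
`l₂l₃ = (x₀x₃)(x₁x₂) = (x₀x₁)(x₂x₃) = h₀h₁` — the hypotheses `pl₁l₄`, `pl₂l₃` of section `Atoms` (the
Pfaffian signs; cf. `DividedSquareLemma.sq_eq_two_mul_pfaffian_smul`). -/
theorem table_signed (x₀ x₁ x₂ x₃ : M) :
    ι R x₀ * ι R x₂ * (ι R x₁ * ι R x₃) = -(ι R x₀ * ι R x₁ * (ι R x₂ * ι R x₃)) ∧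
    ι R x₀ * ι R x₃ * (ι R x₁ * ι R x₂) = ι R x₀ * ι R x₁ * (ι R x₂ * ι R x₃) := by
  constructor
  · rw [mul_assoc, ← mul_assoc (ι R x₂), ι_mul_ι_eq_neg x₂ x₁, neg_mul, mul_neg, mul_assoc, ← mul_assoc]
  · rw [mul_assoc, ← two_form_comm x₁ x₂ (ι R x₃), mul_assoc, ← mul_assoc]

end Convention

section Atoms

/-! ### 1. The atom table: pair sums, slot sums, cross lines -/

variable {R : Type*} [CommRing R]

/-- **Atom table, slot pair.** `H = h₀ + h₁`, `H₂ = h₀h₁`, `h₀² = h₁² = 0` ⟹ `H·H = 2H₂` (`H₂ = H^[2]`). -/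
theorem pairSum_sq (h₀ h₁ H H₂ : R) (hH : H = h₀ + h₁) (hH₂ : H₂ = h₀ * h₁) (qh₀ : h₀ * h₀ = 0) (qh₁
    : h₁ * h₁ = 0) :
    H * H = 2 * H₂ := by
  linear_combination (h₁ + h₀ + H) * hH + ((-2)) * hH₂ + (1) * qh₀ + (1) * qh₁

/-- `H·H₂ = 0`. -/
theorem pairSum_mul (h₀ h₁ H H₂ : R) (hH : H = h₀ + h₁) (hH₂ : H₂ = h₀ * h₁) (qh₀ : h₀ * h₀ = 0)
    (qh₁ : h₁ * h₁ = 0) :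
    H * H₂ = 0 := by
  linear_combination (H₂) * hH + (h₁ + h₀) * hH₂ + (h₁) * qh₀ + (h₀) * qh₁

/-- `H₂·H₂ = 0`. -/
theorem pairSum_top (h₀ h₁ H₂ : R) (hH₂ : H₂ = h₀ * h₁) (qh₀ : h₀ * h₀ = 0) :
    H₂ * H₂ = 0 := by
  linear_combination (h₀ * h₁ + H₂) * hH₂ + (h₁ ^ 2) * qh₀

/-- **Atom table, outer slots** (`S_k` = the `k`-th elementary symmetric polynomial of `h₂, h₃, h₄, h₅`, `hᵢ² =
0`; the products are the divided-power law `S_j S_k = C(j+k, j) S_{j+k}`, `S_k = 0` for `k > 4`): `S₁·S₁ =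
2S₂`. -/
theorem slotSum_11 (h₂ h₃ h₄ h₅ S₁ S₂ : R) (hS₁ : S₁ = h₂ + h₃ + h₄ + h₅) (hS₂ : S₂ = h₂ * h₃ + h₂ *
    h₄ + h₂ * h₅ + h₃ * h₄ + h₃ * h₅ + h₄ * h₅) (qh₂ : h₂ * h₂ = 0) (qh₃ : h₃ * h₃ = 0) (qh₄ : h₄ *
    h₄ = 0) (qh₅ : h₅ * h₅ = 0) :
    S₁ * S₁ = 2 * S₂ := by
  linear_combination (h₅ + h₄ + h₃ + h₂ + S₁) * hS₁ + ((-2)) * hS₂ + (1) * qh₂ + (1) * qh₃ + (1) *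
    qh₄ + (1) * qh₅

/-- `S₁·S₂ = 3S₃`. -/
theorem slotSum_12 (h₂ h₃ h₄ h₅ S₁ S₂ S₃ : R) (hS₁ : S₁ = h₂ + h₃ + h₄ + h₅) (hS₂ : S₂ = h₂ * h₃ +
    h₂ * h₄ + h₂ * h₅ + h₃ * h₄ + h₃ * h₅ + h₄ * h₅) (hS₃ : S₃ = h₂ * h₃ * h₄ + h₂ * h₃ * h₅ + h₂ *
    h₄ * h₅ + h₃ * h₄ * h₅) (qh₂ : h₂ * h₂ = 0) (qh₃ : h₃ * h₃ = 0) (qh₄ : h₄ * h₄ = 0) (qh₅ : h₅ *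
    h₅ = 0) :
    S₁ * S₂ = 3 * S₃ := by
  linear_combination (S₂) * hS₁ + (h₅ + h₄ + h₃ + h₂) * hS₂ + ((-3)) * hS₃ + (h₅ + h₄ + h₃) * qh₂ +
    (h₅ + h₄ + h₂) * qh₃ + (h₅ + h₃ + h₂) * qh₄ + (h₄ + h₃ + h₂) * qh₅

/-- `S₁·S₃ = 4S₄`. -/
theorem slotSum_13 (h₂ h₃ h₄ h₅ S₁ S₃ S₄ : R) (hS₁ : S₁ = h₂ + h₃ + h₄ + h₅) (hS₃ : S₃ = h₂ * h₃ *
    h₄ + h₂ * h₃ * h₅ + h₂ * h₄ * h₅ + h₃ * h₄ * h₅) (hS₄ : S₄ = h₂ * h₃ * h₄ * h₅) (qh₂ : h₂ * h₂ =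
    0) (qh₃ : h₃ * h₃ = 0) (qh₄ : h₄ * h₄ = 0) (qh₅ : h₅ * h₅ = 0) :
    S₁ * S₃ = 4 * S₄ := by
  linear_combination (S₃) * hS₁ + (h₅ + h₄ + h₃ + h₂) * hS₃ + ((-4)) * hS₄ + (h₄ * h₅ + h₃ * h₅ + h₃
    * h₄) * qh₂ + (h₄ * h₅ + h₂ * h₅ + h₂ * h₄) * qh₃ + (h₃ * h₅ + h₂ * h₅ + h₂ * h₃) * qh₄ + (h₃ *
    h₄ + h₂ * h₄ + h₂ * h₃) * qh₅

/-- `S₂·S₂ = 6S₄`. -/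
theorem slotSum_22 (h₂ h₃ h₄ h₅ S₂ S₄ : R) (hS₂ : S₂ = h₂ * h₃ + h₂ * h₄ + h₂ * h₅ + h₃ * h₄ + h₃ *
    h₅ + h₄ * h₅) (hS₄ : S₄ = h₂ * h₃ * h₄ * h₅) (qh₂ : h₂ * h₂ = 0) (qh₃ : h₃ * h₃ = 0) (qh₄ : h₄ *
    h₄ = 0) (qh₅ : h₅ * h₅ = 0) :
    S₂ * S₂ = 6 * S₄ := by
  linear_combination (h₄ * h₅ + h₃ * h₅ + h₃ * h₄ + h₂ * h₅ + h₂ * h₄ + h₂ * h₃ + S₂) * hS₂ + ((-6))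
    * hS₄ + (h₅ ^ 2 + (2) * h₄ * h₅ + h₄ ^ 2 + (2) * h₃ * h₅ + (2) * h₃ * h₄ + h₃ ^ 2) * qh₂ + (h₅ ^
    2 + (2) * h₄ * h₅ + h₄ ^ 2 + (2) * h₂ * h₅ + (2) * h₂ * h₄) * qh₃ + (h₅ ^ 2 + (2) * h₃ * h₅ +
    (2) * h₂ * h₅ + (2) * h₂ * h₃) * qh₄ + ((2) * h₃ * h₄ + (2) * h₂ * h₄ + (2) * h₂ * h₃) * qh₅

/-- `S₁·S₄ = 0`. -/
theorem slotSum_14 (h₂ h₃ h₄ h₅ S₁ S₄ : R) (hS₁ : S₁ = h₂ + h₃ + h₄ + h₅) (hS₄ : S₄ = h₂ * h₃ * h₄ *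
    h₅) (qh₂ : h₂ * h₂ = 0) (qh₃ : h₃ * h₃ = 0) (qh₄ : h₄ * h₄ = 0) (qh₅ : h₅ * h₅ = 0) :
    S₁ * S₄ = 0 := by
  linear_combination (S₄) * hS₁ + (h₅ + h₄ + h₃ + h₂) * hS₄ + (h₃ * h₄ * h₅) * qh₂ + (h₂ * h₄ * h₅)
    * qh₃ + (h₂ * h₃ * h₅) * qh₄ + (h₂ * h₃ * h₄) * qh₅

/-- `S₂·S₃ = 0`. -/
theorem slotSum_23 (h₂ h₃ h₄ h₅ S₂ S₃ : R) (hS₂ : S₂ = h₂ * h₃ + h₂ * h₄ + h₂ * h₅ + h₃ * h₄ + h₃ *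
    h₅ + h₄ * h₅) (hS₃ : S₃ = h₂ * h₃ * h₄ + h₂ * h₃ * h₅ + h₂ * h₄ * h₅ + h₃ * h₄ * h₅) (qh₂ : h₂ *
    h₂ = 0) (qh₃ : h₃ * h₃ = 0) (qh₄ : h₄ * h₄ = 0) (qh₅ : h₅ * h₅ = 0) :
    S₂ * S₃ = 0 := by
  linear_combination (S₃) * hS₂ + (h₄ * h₅ + h₃ * h₅ + h₃ * h₄ + h₂ * h₅ + h₂ * h₄ + h₂ * h₃) * hS₃
    + (h₄ * h₅ ^ 2 + h₄ ^ 2 * h₅ + h₃ * h₅ ^ 2 + (3) * h₃ * h₄ * h₅ + h₃ * h₄ ^ 2 + h₃ ^ 2 * h₅ + h₃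
    ^ 2 * h₄) * qh₂ + (h₄ * h₅ ^ 2 + h₄ ^ 2 * h₅ + h₂ * h₅ ^ 2 + (3) * h₂ * h₄ * h₅ + h₂ * h₄ ^ 2) *
    qh₃ + (h₃ * h₅ ^ 2 + h₂ * h₅ ^ 2 + (3) * h₂ * h₃ * h₅) * qh₄ + ((3) * h₂ * h₃ * h₄) * qh₅

/-- `S₂·S₄ = 0`. -/
theorem slotSum_24 (h₂ h₃ h₄ h₅ S₂ S₄ : R) (hS₂ : S₂ = h₂ * h₃ + h₂ * h₄ + h₂ * h₅ + h₃ * h₄ + h₃ *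
    h₅ + h₄ * h₅) (hS₄ : S₄ = h₂ * h₃ * h₄ * h₅) (qh₂ : h₂ * h₂ = 0) (qh₃ : h₃ * h₃ = 0) (qh₄ : h₄ *
    h₄ = 0) :
    S₂ * S₄ = 0 := by
  linear_combination (S₄) * hS₂ + (h₄ * h₅ + h₃ * h₅ + h₃ * h₄ + h₂ * h₅ + h₂ * h₄ + h₂ * h₃) * hS₄
    + (h₃ * h₄ * h₅ ^ 2 + h₃ * h₄ ^ 2 * h₅ + h₃ ^ 2 * h₄ * h₅) * qh₂ + (h₂ * h₄ * h₅ ^ 2 + h₂ * h₄ ^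
    2 * h₅) * qh₃ + (h₂ * h₃ * h₅ ^ 2) * qh₄

/-- `S₃·S₃ = 0`. -/
theorem slotSum_33 (h₂ h₃ h₄ h₅ S₃ : R) (hS₃ : S₃ = h₂ * h₃ * h₄ + h₂ * h₃ * h₅ + h₂ * h₄ * h₅ + h₃
    * h₄ * h₅) (qh₂ : h₂ * h₂ = 0) (qh₃ : h₃ * h₃ = 0) (qh₄ : h₄ * h₄ = 0) :
    S₃ * S₃ = 0 := by
  linear_combination (h₃ * h₄ * h₅ + h₂ * h₄ * h₅ + h₂ * h₃ * h₅ + h₂ * h₃ * h₄ + S₃) * hS₃ + (h₄ ^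
    2 * h₅ ^ 2 + (2) * h₃ * h₄ * h₅ ^ 2 + (2) * h₃ * h₄ ^ 2 * h₅ + h₃ ^ 2 * h₅ ^ 2 + (2) * h₃ ^ 2 *
    h₄ * h₅ + h₃ ^ 2 * h₄ ^ 2) * qh₂ + (h₄ ^ 2 * h₅ ^ 2 + (2) * h₂ * h₄ * h₅ ^ 2 + (2) * h₂ * h₄ ^ 2
    * h₅) * qh₃ + ((2) * h₂ * h₃ * h₅ ^ 2) * qh₄

/-- `S₃·S₄ = 0`. -/
theorem slotSum_34 (h₂ h₃ h₄ h₅ S₃ S₄ : R) (hS₃ : S₃ = h₂ * h₃ * h₄ + h₂ * h₃ * h₅ + h₂ * h₄ * h₅ +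
    h₃ * h₄ * h₅) (hS₄ : S₄ = h₂ * h₃ * h₄ * h₅) (qh₂ : h₂ * h₂ = 0) (qh₃ : h₃ * h₃ = 0) :
    S₃ * S₄ = 0 := by
  linear_combination (S₄) * hS₃ + (h₃ * h₄ * h₅ + h₂ * h₄ * h₅ + h₂ * h₃ * h₅ + h₂ * h₃ * h₄) * hS₄
    + (h₃ * h₄ ^ 2 * h₅ ^ 2 + h₃ ^ 2 * h₄ * h₅ ^ 2 + h₃ ^ 2 * h₄ ^ 2 * h₅) * qh₂ + (h₂ * h₄ ^ 2 * h₅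
    ^ 2) * qh₃

/-- `S₄·S₄ = 0`. -/
theorem slotSum_44 (h₂ h₃ h₄ h₅ S₄ : R) (hS₄ : S₄ = h₂ * h₃ * h₄ * h₅) (qh₂ : h₂ * h₂ = 0) :
    S₄ * S₄ = 0 := by
  linear_combination (h₂ * h₃ * h₄ * h₅ + S₄) * hS₄ + (h₃ ^ 2 * h₄ ^ 2 * h₅ ^ 2) * qh₂

/-- `S₁·G = S₄` for `G := h₃h₄h₅` (so `S₁·h₃h₄h₅ = h₂h₃h₄h₅`, the functional «coefficient of `h₂`» used by
`DegreeSixSecondDigit.obstruction`). -/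
theorem slotSum_G (h₂ h₃ h₄ h₅ S₁ S₄ G : R) (hG : G = h₃ * h₄ * h₅) (hS₁ : S₁ = h₂ + h₃ + h₄ + h₅)
    (hS₄ : S₄ = h₂ * h₃ * h₄ * h₅) (qh₃ : h₃ * h₃ = 0) (qh₄ : h₄ * h₄ = 0) (qh₅ : h₅ * h₅ = 0) :
    S₁ * G = S₄ := by
  linear_combination (S₁) * hG + (h₃ * h₄ * h₅) * hS₁ + ((-1)) * hS₄ + (h₄ * h₅) * qh₃ + (h₃ * h₅) *
    qh₄ + (h₃ * h₄) * qh₅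

/-- **Atom table, cross lines.** For `L = a l₁ + b l₂ + c l₃ + d l₄` (any coefficients) on the four cross lines
of the slot pair, the 2-vector table gives `L·L = 2(bc − ad)·h₀h₁` — so `L·L = 2L₂` with `L₂ = L^[2] = λH₂`,
`λ = bc − ad` (`crossLine_dividedSquare`). -/
theorem crossLine_sq (h₀ h₁ l₁ l₂ l₃ l₄ a b c d L : R) (hL : L = a * l₁ + b * l₂ + c * l₃ + d * l₄)
    (ql₁ : l₁ * l₁ = 0) (ql₂ : l₂ * l₂ = 0) (ql₃ : l₃ * l₃ = 0) (ql₄ : l₄ * l₄ = 0) (zl₁l₂ : l₁ * l₂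
    = 0) (zl₁l₃ : l₁ * l₃ = 0) (zl₂l₄ : l₂ * l₄ = 0) (zl₃l₄ : l₃ * l₄ = 0) (pl₁l₄ : l₁ * l₄ = -(h₀ *
    h₁)) (pl₂l₃ : l₂ * l₃ = h₀ * h₁) :
    L * L = 2 * ((b * c - a * d) * (h₀ * h₁)) := by
  linear_combination (l₄ * d + l₃ * c + l₂ * b + l₁ * a + L) * hL + (a ^ 2) * ql₁ + (b ^ 2) * ql₂ +
    (c ^ 2) * ql₃ + (d ^ 2) * ql₄ + ((2) * a * b) * zl₁l₂ + ((2) * a * c) * zl₁l₃ + ((2) * b * d) *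
    zl₂l₄ + ((2) * c * d) * zl₃l₄ + ((2) * a * d) * pl₁l₄ + ((2) * b * c) * pl₂l₃

/-- `h₀·L = 0` (hence `H·L = H₂·L = 0`, the hypotheses `zHL`, `zH₂L`). -/
theorem crossLine_h₀ (h₀ l₁ l₂ l₃ l₄ a b c d L : R) (hL : L = a * l₁ + b * l₂ + c * l₃ + d * l₄)
    (zh₀l₁ : h₀ * l₁ = 0) (zh₀l₂ : h₀ * l₂ = 0) (zh₀l₃ : h₀ * l₃ = 0) (zh₀l₄ : h₀ * l₄ = 0) :
    h₀ * L = 0 := by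
  linear_combination (h₀) * hL + (a) * zh₀l₁ + (b) * zh₀l₂ + (c) * zh₀l₃ + (d) * zh₀l₄

/-- `h₁·L = 0`. -/
theorem crossLine_h₁ (h₁ l₁ l₂ l₃ l₄ a b c d L : R) (hL : L = a * l₁ + b * l₂ + c * l₃ + d * l₄)
    (zh₁l₁ : h₁ * l₁ = 0) (zh₁l₂ : h₁ * l₂ = 0) (zh₁l₃ : h₁ * l₃ = 0) (zh₁l₄ : h₁ * l₄ = 0) :
    h₁ * L = 0 := by
  linear_combination (h₁) * hL + (a) * zh₁l₁ + (b) * zh₁l₂ + (c) * zh₁l₃ + (d) * zh₁l₄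

/-- `L^[2] = (bc − ad)·h₀h₁`: the elementary symmetric square `M₂` of the four summands `a l₁, b l₂, c l₃, d
l₄`. -/
theorem crossLine_dividedSquare (h₀ h₁ l₁ l₂ l₃ l₄ a b c d M₂ : R) (hM₂ : M₂ = a * l₁ * (b * l₂) + a
    * l₁ * (c * l₃) + a * l₁ * (d * l₄) + b * l₂ * (c * l₃) + b * l₂ * (d * l₄) + c * l₃ * (d * l₄))
    (zl₁l₂ : l₁ * l₂ = 0) (zl₁l₃ : l₁ * l₃ = 0) (zl₂l₄ : l₂ * l₄ = 0) (zl₃l₄ : l₃ * l₄ = 0) (pl₁l₄ :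
    l₁ * l₄ = -(h₀ * h₁)) (pl₂l₃ : l₂ * l₃ = h₀ * h₁) :
    M₂ = (b * c - a * d) * (h₀ * h₁) := by
  linear_combination (1) * hM₂ + (a * b) * zl₁l₂ + (a * c) * zl₁l₃ + (b * d) * zl₂l₄ + (c * d) *
    zl₃l₄ + (a * d) * pl₁l₄ + (b * c) * pl₂l₃

/-- `L^[3] = 0`: the elementary symmetric cube `M₃` of the four summands vanishes (so `B^[3]` below has no `L₃`
term). -/
theorem crossLine_dividedCube (l₁ l₂ l₃ l₄ a b c d M₃ : R) (hM₃ : M₃ = a * l₁ * (b * l₂) * (c * l₃)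
    + a * l₁ * (b * l₂) * (d * l₄) + a * l₁ * (c * l₃) * (d * l₄) + b * l₂ * (c * l₃) * (d * l₄))
    (zl₁l₂ : l₁ * l₂ = 0) (zl₁l₃ : l₁ * l₃ = 0) (zl₂l₄ : l₂ * l₄ = 0) :
    M₃ = 0 := by
  linear_combination (1) * hM₃ + (l₄ * a * b * d + l₃ * a * b * c) * zl₁l₂ + (l₄ * a * c * d) *
    zl₁l₃ + (l₃ * b * c * d) * zl₂l₄

/-- **Pairing of cross lines.** For `N = n₁l₁ + n₂l₂ + n₃l₃ + n₄l₄`: `l₄·N = −n₁·h₀h₁` (only the complementary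
line pairs non-trivially: `l₁l₄ = −h₀h₁`). -/
theorem crossLine_pair₄ (h₀ h₁ l₁ l₂ l₃ l₄ n₁ n₂ n₃ n₄ N : R) (hN : N = n₁ * l₁ + n₂ * l₂ + n₃ * l₃
    + n₄ * l₄) (ql₄ : l₄ * l₄ = 0) (zl₂l₄ : l₂ * l₄ = 0) (zl₃l₄ : l₃ * l₄ = 0) (pl₁l₄ : l₁ * l₄ =
    -(h₀ * h₁)) :
    l₄ * N = -n₁ * (h₀ * h₁) := by
  linear_combination (l₄) * hN + (n₄) * ql₄ + (n₂) * zl₂l₄ + (n₃) * zl₃l₄ + (n₁) * pl₁l₄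

/-- `l₃·N = n₂·h₀h₁` (`l₂l₃ = h₀h₁`). -/
theorem crossLine_pair₃ (h₀ h₁ l₁ l₂ l₃ l₄ n₁ n₂ n₃ n₄ N : R) (hN : N = n₁ * l₁ + n₂ * l₂ + n₃ * l₃
    + n₄ * l₄) (ql₃ : l₃ * l₃ = 0) (zl₁l₃ : l₁ * l₃ = 0) (zl₃l₄ : l₃ * l₄ = 0) (pl₂l₃ : l₂ * l₃ = h₀
    * h₁) :
    l₃ * N = n₂ * (h₀ * h₁) := by
  linear_combination (l₃) * hN + (n₃) * ql₃ + (n₁) * zl₁l₃ + (n₄) * zl₃l₄ + (n₂) * pl₂l₃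

/-- `l₂·N = n₃·h₀h₁`. -/
theorem crossLine_pair₂ (h₀ h₁ l₁ l₂ l₃ l₄ n₁ n₂ n₃ n₄ N : R) (hN : N = n₁ * l₁ + n₂ * l₂ + n₃ * l₃
    + n₄ * l₄) (ql₂ : l₂ * l₂ = 0) (zl₁l₂ : l₁ * l₂ = 0) (zl₂l₄ : l₂ * l₄ = 0) (pl₂l₃ : l₂ * l₃ = h₀
    * h₁) :
    l₂ * N = n₃ * (h₀ * h₁) := by
  linear_combination (l₂) * hN + (n₂) * ql₂ + (n₁) * zl₁l₂ + (n₄) * zl₂l₄ + (n₃) * pl₂l₃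

/-- `l₁·N = −n₄·h₀h₁`. These give the hypothesis `hFN : F·N = ϖ·h₀h₁` of `DegreeSixSecondDigit.obstruction` with
`F` a cross line complementary to an odd coefficient of `N`. -/
theorem crossLine_pair₁ (h₀ h₁ l₁ l₂ l₃ l₄ n₁ n₂ n₃ n₄ N : R) (hN : N = n₁ * l₁ + n₂ * l₂ + n₃ * l₃
    + n₄ * l₄) (ql₁ : l₁ * l₁ = 0) (zl₁l₂ : l₁ * l₂ = 0) (zl₁l₃ : l₁ * l₃ = 0) (pl₁l₄ : l₁ * l₄ =
    -(h₀ * h₁)) :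
    l₁ * N = -n₄ * (h₀ * h₁) := by
  linear_combination (l₁) * hN + (n₁) * ql₁ + (n₂) * zl₁l₂ + (n₃) * zl₁l₃ + (n₄) * pl₁l₄

/-- **Atom law for 3 clique slots** (`P_k` = elementary symmetric polynomials of 3 square-zero commuting
elements; `n = 4` is `TwoSlotFrameTable.slotSum_11 ∕ _12`): `P₁·P₁ = 2P₂`. -/
theorem cliqueSum_11_3 (h₀ h₁ h₂ P₁ P₂ : R) (hP₁ : P₁ = h₀ + h₁ + h₂) (hP₂ : P₂ = h₀ * h₁ + h₀ * h₂
    + h₁ * h₂) (qh₀ : h₀ * h₀ = 0) (qh₁ : h₁ * h₁ = 0) (qh₂ : h₂ * h₂ = 0) :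
    P₁ * P₁ = 2 * P₂ := by
  linear_combination (h₂ + h₁ + h₀ + P₁) * hP₁ + ((-2)) * hP₂ + (1) * qh₀ + (1) * qh₁ + (1) * qh₂

/-- `P₁·P₂ = 3P₃` for 3 clique slots. -/
theorem cliqueSum_12_3 (h₀ h₁ h₂ P₁ P₂ P₃ : R) (hP₁ : P₁ = h₀ + h₁ + h₂) (hP₂ : P₂ = h₀ * h₁ + h₀ *
    h₂ + h₁ * h₂) (hP₃ : P₃ = h₀ * h₁ * h₂) (qh₀ : h₀ * h₀ = 0) (qh₁ : h₁ * h₁ = 0) (qh₂ : h₂ * h₂ =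
    0) :
    P₁ * P₂ = 3 * P₃ := by
  linear_combination (P₂) * hP₁ + (h₂ + h₁ + h₀) * hP₂ + ((-3)) * hP₃ + (h₂ + h₁) * qh₀ + (h₂ + h₀)
    * qh₁ + (h₁ + h₀) * qh₂

/-- **Atom law for 5 clique slots** (`P_k` = elementary symmetric polynomials of 5 square-zero commuting
elements; `n = 4` is `TwoSlotFrameTable.slotSum_11 ∕ _12`): `P₁·P₁ = 2P₂`. -/
theorem cliqueSum_11_5 (h₀ h₁ h₂ h₃ h₄ P₁ P₂ : R) (hP₁ : P₁ = h₀ + h₁ + h₂ + h₃ + h₄) (hP₂ : P₂ = h₀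
    * h₁ + h₀ * h₂ + h₀ * h₃ + h₀ * h₄ + h₁ * h₂ + h₁ * h₃ + h₁ * h₄ + h₂ * h₃ + h₂ * h₄ + h₃ * h₄)
    (qh₀ : h₀ * h₀ = 0) (qh₁ : h₁ * h₁ = 0) (qh₂ : h₂ * h₂ = 0) (qh₃ : h₃ * h₃ = 0) (qh₄ : h₄ * h₄ =
    0) :
    P₁ * P₁ = 2 * P₂ := by
  linear_combination (h₄ + h₃ + h₂ + h₁ + h₀ + P₁) * hP₁ + ((-2)) * hP₂ + (1) * qh₀ + (1) * qh₁ +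
    (1) * qh₂ + (1) * qh₃ + (1) * qh₄

/-- `P₁·P₂ = 3P₃` for 5 clique slots. -/
theorem cliqueSum_12_5 (h₀ h₁ h₂ h₃ h₄ P₁ P₂ P₃ : R) (hP₁ : P₁ = h₀ + h₁ + h₂ + h₃ + h₄) (hP₂ : P₂ =
    h₀ * h₁ + h₀ * h₂ + h₀ * h₃ + h₀ * h₄ + h₁ * h₂ + h₁ * h₃ + h₁ * h₄ + h₂ * h₃ + h₂ * h₄ + h₃ *
    h₄) (hP₃ : P₃ = h₀ * h₁ * h₂ + h₀ * h₁ * h₃ + h₀ * h₁ * h₄ + h₀ * h₂ * h₃ + h₀ * h₂ * h₄ + h₀ *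
    h₃ * h₄ + h₁ * h₂ * h₃ + h₁ * h₂ * h₄ + h₁ * h₃ * h₄ + h₂ * h₃ * h₄) (qh₀ : h₀ * h₀ = 0) (qh₁ :
    h₁ * h₁ = 0) (qh₂ : h₂ * h₂ = 0) (qh₃ : h₃ * h₃ = 0) (qh₄ : h₄ * h₄ = 0) :
    P₁ * P₂ = 3 * P₃ := by
  linear_combination (P₂) * hP₁ + (h₄ + h₃ + h₂ + h₁ + h₀) * hP₂ + ((-3)) * hP₃ + (h₄ + h₃ + h₂ +
    h₁) * qh₀ + (h₄ + h₃ + h₂ + h₀) * qh₁ + (h₄ + h₃ + h₁ + h₀) * qh₂ + (h₄ + h₂ + h₁ + h₀) * qh₃ +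
    (h₃ + h₂ + h₁ + h₀) * qh₄

/-- **Atom law for 6 clique slots** (`P_k` = elementary symmetric polynomials of 6 square-zero commuting
elements; `n = 4` is `TwoSlotFrameTable.slotSum_11 ∕ _12`): `P₁·P₁ = 2P₂`. -/
theorem cliqueSum_11_6 (h₀ h₁ h₂ h₃ h₄ h₅ P₁ P₂ : R) (hP₁ : P₁ = h₀ + h₁ + h₂ + h₃ + h₄ + h₅) (hP₂ :
    P₂ = h₀ * h₁ + h₀ * h₂ + h₀ * h₃ + h₀ * h₄ + h₀ * h₅ + h₁ * h₂ + h₁ * h₃ + h₁ * h₄ + h₁ * h₅ +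
    h₂ * h₃ + h₂ * h₄ + h₂ * h₅ + h₃ * h₄ + h₃ * h₅ + h₄ * h₅) (qh₀ : h₀ * h₀ = 0) (qh₁ : h₁ * h₁ =
    0) (qh₂ : h₂ * h₂ = 0) (qh₃ : h₃ * h₃ = 0) (qh₄ : h₄ * h₄ = 0) (qh₅ : h₅ * h₅ = 0) :
    P₁ * P₁ = 2 * P₂ := by
  linear_combination (h₅ + h₄ + h₃ + h₂ + h₁ + h₀ + P₁) * hP₁ + ((-2)) * hP₂ + (1) * qh₀ + (1) * qh₁
    + (1) * qh₂ + (1) * qh₃ + (1) * qh₄ + (1) * qh₅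

/-- `P₁·P₂ = 3P₃` for 6 clique slots. -/
theorem cliqueSum_12_6 (h₀ h₁ h₂ h₃ h₄ h₅ P₁ P₂ P₃ : R) (hP₁ : P₁ = h₀ + h₁ + h₂ + h₃ + h₄ + h₅)
    (hP₂ : P₂ = h₀ * h₁ + h₀ * h₂ + h₀ * h₃ + h₀ * h₄ + h₀ * h₅ + h₁ * h₂ + h₁ * h₃ + h₁ * h₄ + h₁ *
    h₅ + h₂ * h₃ + h₂ * h₄ + h₂ * h₅ + h₃ * h₄ + h₃ * h₅ + h₄ * h₅) (hP₃ : P₃ = h₀ * h₁ * h₂ + h₀ *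
    h₁ * h₃ + h₀ * h₁ * h₄ + h₀ * h₁ * h₅ + h₀ * h₂ * h₃ + h₀ * h₂ * h₄ + h₀ * h₂ * h₅ + h₀ * h₃ *
    h₄ + h₀ * h₃ * h₅ + h₀ * h₄ * h₅ + h₁ * h₂ * h₃ + h₁ * h₂ * h₄ + h₁ * h₂ * h₅ + h₁ * h₃ * h₄ +
    h₁ * h₃ * h₅ + h₁ * h₄ * h₅ + h₂ * h₃ * h₄ + h₂ * h₃ * h₅ + h₂ * h₄ * h₅ + h₃ * h₄ * h₅) (qh₀ :
    h₀ * h₀ = 0) (qh₁ : h₁ * h₁ = 0) (qh₂ : h₂ * h₂ = 0) (qh₃ : h₃ * h₃ = 0) (qh₄ : h₄ * h₄ = 0)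
    (qh₅ : h₅ * h₅ = 0) :
    P₁ * P₂ = 3 * P₃ := by
  linear_combination (P₂) * hP₁ + (h₅ + h₄ + h₃ + h₂ + h₁ + h₀) * hP₂ + ((-3)) * hP₃ + (h₅ + h₄ + h₃
    + h₂ + h₁) * qh₀ + (h₅ + h₄ + h₃ + h₂ + h₀) * qh₁ + (h₅ + h₄ + h₃ + h₁ + h₀) * qh₂ + (h₅ + h₄ +
    h₂ + h₁ + h₀) * qh₃ + (h₅ + h₃ + h₂ + h₁ + h₀) * qh₄ + (h₄ + h₃ + h₂ + h₁ + h₀) * qh₅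

end Atoms

end Summit.Ventures.HSemireg.TwoSlotFrameTable
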